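/-
Origin: expansion seat `planner-pub-hodgecm-pv09-0`, handover 2026-08-18T03:42:11Z (`HOME/pub-hodgecm-pv09/lean/Pv09/ThetaContinuity.lean`, md5 fc8818bd, 57 lines);
landed by the gen-5 packager in gate run 19 as `HodgeCM/PerL34/ThetaContinuity.lean` (verbatim).
-/
/-
pub-hodgecm speedrun cell, prover pv09 — WIP module `Pv09.ThetaContinuity` (landing target
`HodgeCM/PerL34/ThetaContinuity.lean`).  Imports: Mathlib only.

KERNEL form of the last clause of DAG node N22 (PerL v5 §3.3, tex ll. 394–396):
  "The kernel θ_Φ is continuous on [G_U] × U(W)(𝔸), so (g,h) ↦ ϑ_{T,χ}(ω(h)Φ)(g) = ∫_{[T]} θ_Φ(g,th)χ(t)dt is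
   jointly continuous and h ↦ ϑ_{T,χ}(ω(h)Φ) is continuous into C([G_U])"
(= the SHAPE of the frozen interface field `TorusData.AX12_transl_cont`, which any concrete model must supply).
MODEL: `K` = [G_U] (a locally compact space; compact in PerL), `Gp` = U(W)(𝔸) (locally compact), the compact
quotient [T] = T(L₀)\T(𝔸) is integrated over a COMPACT subset `Ω` (closure of a fundamental domain of T(L₀) in
T(𝔸)) of a space `Y` (= T(𝔸)) acting continuously on `Gp` by `act` (t·h), with a locally finite measure `ν`
(Haar of T(𝔸)); `Θ : K → Gp → ℂ` jointly continuous (θ_Φ(g, y)), `χ : Y → ℂ` continuous.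
-/
import Mathlib.MeasureTheory.Integral.Bochner.Set
import Mathlib.Topology.CompactOpen

/-! PORT of `HodgeCM/PerL34/ThetaContinuity.lean` (HodgeCMPerL run 81) — verbatim mechanical port; provenance in the PORT header line. -/

set_option autoImplicit false

open MeasureTheory Function

namespace HodgeCM.PerL34.ThetaCont

variable {K Gp Y : Type*} [TopologicalSpace K] [TopologicalSpace Gp] [TopologicalSpace Y]
  [MeasurableSpace Y] [OpensMeasurableSpace Y]

/-- `ϑ_{T,χ}(ω(h)Φ)(g) = ∫_{Ω} Θ(g, t·h) χ(t) dν(t)` (tex l. 395), as a function of `(g,h)`. -/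
noncomputable def thetaT (Θ : K → Gp → ℂ) (act : Y → Gp → Gp) (χ : Y → ℂ) (Ω : Set Y) (ν : Measure Y)
    (p : K × Gp) : ℂ :=
  ∫ t in Ω, Θ p.1 (act t p.2) * χ t ∂ν

/-- **Joint continuity** (tex l. 395): `(g,h) ↦ ϑ_{T,χ}(ω(h)Φ)(g)` is continuous. -/
theorem continuous_thetaT [LocallyCompactSpace (K × Gp)] [FirstCountableTopology (K × Gp)]
    {Θ : K → Gp → ℂ} (hΘ : Continuous (uncurry Θ)) {act : Y → Gp → Gp} (hact : Continuous (uncurry act))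
    {χ : Y → ℂ} (hχ : Continuous χ) {Ω : Set Y} (hΩ : IsCompact Ω) (ν : Measure Y)
    [IsLocallyFiniteMeasure ν] : Continuous (thetaT Θ act χ Ω ν) := by
  unfold thetaT
  apply continuous_parametric_integral_of_continuous (f := fun (p : K × Gp) (t : Y) => Θ p.1 (act t p.2) * χ t)
    _ hΩ
  -- the integrand (p,t) ↦ Θ(p.1, act t p.2) * χ t is jointly continuous
  have h1 : Continuous fun q : (K × Gp) × Y => Θ q.1.1 (act q.2 q.1.2) :=
    hΘ.comp (continuous_fst.fst.prodMk (hact.comp (continuous_snd.prodMk continuous_fst.snd)))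
  exact h1.mul (hχ.comp continuous_snd)

/-- **Continuity into `C([G_U])`** (tex l. 395–396): `h ↦ (g ↦ ϑ_{T,χ}(ω(h)Φ)(g))` is continuous
`U(W)(𝔸) → C([G_U], ℂ)` (compact-open topology = the sup-norm topology when [G_U] is compact). -/
theorem continuous_thetaT_curry [LocallyCompactSpace (K × Gp)] [FirstCountableTopology (K × Gp)]
    [LocallyCompactSpace K]
    {Θ : K → Gp → ℂ} (hΘ : Continuous (uncurry Θ)) {act : Y → Gp → Gp} (hact : Continuous (uncurry act))
    {χ : Y → ℂ} (hχ : Continuous χ) {Ω : Set Y} (hΩ : IsCompact Ω) (ν : Measure Y)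
    [IsLocallyFiniteMeasure ν] :
    ∃ F : Gp → C(K, ℂ), Continuous F ∧ ∀ h g, F h g = thetaT Θ act χ Ω ν (g, h) := by
  have hc := continuous_thetaT hΘ hact hχ hΩ ν
  -- swap the factors and curry
  let Fsw : C(Gp × K, ℂ) := ⟨fun q => thetaT Θ act χ Ω ν (q.2, q.1), hc.comp (continuous_snd.prodMk continuous_fst)⟩
  exact ⟨Fsw.curry, Fsw.curry.continuous, fun h g => rfl⟩

end HodgeCM.PerL34.ThetaCont
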